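/-
Copyright: statement-level skeleton of a published paper (lit-balaban cell, Phase-2 proof seat p39 gen 8). No proof claims
beyond what the kernel checks below.
-/
import Literature.MathematicalPhysics.QuantumFieldTheory.Balaban1983to89.B3CxiUniformBound

/-!
# B3 — T. Bałaban, *(Higgs)₂,₃ quantum fields in a finite volume. III. Renormalization*, CMP **88** (1983) 411–445
[Balaban1983Higgs3], p. 437 / pp. 441–442: MODEL-FREE LATTICE SUMS ON ξℤ³ — the `L¹` norms of the kernel profiles
`(ξ·max(1,|u|_∞))^{−q}·e^{−δξ|u|_∞}` (`q = 0, 1, 2`) with the volume element `ξ³`, UNIFORMLY in the spacing `0 < ξ ≤ 1`, the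
exponentially small shell sums `Σ_{k ≠ 0} e^{−a|k|_∞}`, and the "sup × L¹" estimate of a lattice convolution at a far point

statement-level skeleton of published theorems with citation tags; proofs where landed; nothing here is a claim about
the Yang–Mills mass gap

PDF held: `paper:balaban1983-higgs-2-3-quantum-fields-finite-volume` (journal page = PDF page + 410); p. 437 [PDF 27] and
pp. 441–442 [PDF 31–32] read on the ×2 renders `run/shared/lean/pub/pub-balaban/b2b-balaban-ref1/pages/1983-cmp88-higgs23-III/
1983-cmp88-higgs23-III-p027-x2.png`, `…-p031-x2.png`, `…-p032-x2.png`.  Row **B3.Eq3.25-3.32** of `HOME/lit-balaban-r15/ROWS-B3.md`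
(fold owner r15): toolkit file 1 of the p39 gen-8 target — p. 442, the sentence after (3.30), *"where the coefficient at the vertex
[Π_{μμ′ν}] is bounded, and the coefficient at the vertex [Π_{μμ′}] is proportional to (L^{j₀}η)^{−d+2}"* at the zero-field TORUS
instance, by PERIODIZATION of the torus `x′`-sums of (3.26) into sums over ξℤ³ (files `B3TorusKernelUnfolding`,
`B3Pi2CxiTorusBounded`, `B3Pi3CxiTorusBounded`).  The p. 437 kernel bounds *"|C^ξ(y−y′)| ≦ O(1)e^{−½|y−y′|}/|y−y′| … and the
corresponding inequalities for derivatives"* enter those sums only through the three profile classes treated here.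
WHAT IS PROVED (sites `ZSite d = Fin d → ℤ`, sup norm `B3CxiUniformBound.supNorm`; `d = 3` where stated):
* §1 sup-norm bookkeeping (`supNorm_neg`, `supNorm_add_le`, `supNorm_le_add_sub`, boxes `mem_box_iff`, `card_box`).
* §2 SHELL COUNTING: `#{u ∈ ℤ³ : |u|_∞ = n} ≤ 26n²` (`card_shell_le`) and the radial majorization of a finite lattice sum of a
  function of `|u|_∞` (`sum_radial_le`: `Σ_{u∈F} h(|u|_∞) ≤ h(0) + Σ_{1≤n≤M} 26n²h(n)`).
* §3 one-dimensional sums: `Σ_{1≤n<b} n^m e^{−xn} ≤ 32/x^{m+1}` (`m ≤ 2`), `Σ_{1≤n<b} n²e^{−xn} ≤ (16/x²)(1 + 2/x)e^{−x/2}`.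
* §4 **`tsum_profile_le`**: for `0 < ξ ≤ 1`, `0 < δ ≤ 1`, `q ≤ 2`: `Σ'_{u∈ℤ³} ξ³(ξ·max(1,|u|_∞))^{−q}e^{−δξ|u|_∞} ≤ 833/δ³` (summable);
  **`tsum_exp_supNorm_ne_zero_le`**: `Σ'_{k≠0} e^{−a|k|_∞} ≤ (416/a²)(1 + 2/a)e^{−a/2}` (`a > 0`); `profile_antitone` (far sup).
* §5 **`tsum_mul_sub_le_far`** (any `d`): for nonnegative summable `F, G` on ℤ^d with `F ≤ s_F`, `G ≤ s_G` outside the ball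
  `|·|_∞ < R` and `2R ≤ |v|_∞`: `Σ'_w F(w)G(v − w) ≤ s_F·Σ'G + (Σ'F)·s_G` (one factor is always far from its singularity).
Mathlib + the cited tree file only; theorems only, no definitions, no named facts; standard axioms.  Unit `lit-balaban-p39-g8`
(Phase-2 proof seat p39, gen 8), HOME `run/shared/lean/pub/lit-balaban/`, 2026-08-21.
-/

open scoped BigOperators
open Finset

namespace Literature.MathematicalPhysics.QuantumFieldTheory.Balaban1983to89.B3ZdLatticeProfileSums

open B3Sect3VectorSelfEnergy B3CxiUniformBound

noncomputable section

variable {d : ℕ}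

/-! ## §1 Sup-norm bookkeeping on ℤ^d -/

/-- kernel: `|y|_∞ ≤ n ↔ ∀ μ, |y_μ| ≤ n`. [cite: Balaban1983Higgs3, (3.16) p.437] -/
theorem supNorm_le_iff (y : ZSite d) (n : ℕ) : supNorm y ≤ n ↔ ∀ μ, (y μ).natAbs ≤ n := by
  unfold supNorm
  rw [Finset.sup_le_iff]
  exact ⟨fun h μ => h μ (Finset.mem_univ μ), fun h μ _ => h μ⟩

/-- kernel: `|0|_∞ = 0`. [cite: Balaban1983Higgs3, (3.16) p.437] -/
theorem supNorm_zero : supNorm (0 : ZSite d) = 0 := by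
  apply Nat.le_zero.1
  rw [supNorm_le_iff]
  intro μ
  simp

/-- kernel: `|y|_∞ = 0 ↔ y = 0`. [cite: Balaban1983Higgs3, (3.16) p.437] -/
theorem supNorm_eq_zero_iff (y : ZSite d) : supNorm y = 0 ↔ y = 0 := by
  constructor
  · intro h
    funext μ
    have h1 := le_supNorm y μ
    rw [h, Nat.le_zero, Int.natAbs_eq_zero] at h1
    exact h1
  · rintro rfl
    exact supNorm_zero

/-- kernel: `|−y|_∞ = |y|_∞`. [cite: Balaban1983Higgs3, (3.16) p.437] -/
theorem supNorm_neg (y : ZSite d) : supNorm (-y) = supNorm y := by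
  unfold supNorm
  exact Finset.sup_congr rfl fun μ _ => by simp

/-- kernel: `|y + z|_∞ ≤ |y|_∞ + |z|_∞`. [cite: Balaban1983Higgs3, (3.16) p.437] -/
theorem supNorm_add_le (y z : ZSite d) : supNorm (y + z) ≤ supNorm y + supNorm z := by
  rw [supNorm_le_iff]
  intro μ
  rw [Pi.add_apply]
  exact (Int.natAbs_add_le _ _).trans (Nat.add_le_add (le_supNorm y μ) (le_supNorm z μ))

/-- kernel: `|v|_∞ ≤ |w|_∞ + |v − w|_∞`. [cite: Balaban1983Higgs3, (3.16) p.437] -/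
theorem supNorm_le_add_sub (v w : ZSite d) : supNorm v ≤ supNorm w + supNorm (v - w) := by
  have h := supNorm_add_le w (v - w)
  rwa [add_sub_cancel] at h

/-- kernel: `1 ≤ |y|_∞` for `y ≠ 0`. [cite: Balaban1983Higgs3, (3.16) p.437] -/
theorem one_le_supNorm {y : ZSite d} (hy : y ≠ 0) : 1 ≤ supNorm y := by
  by_contra h
  exact hy ((supNorm_eq_zero_iff y).1 (by omega))

/-- kernel: the box `{u : |u|_∞ ≤ M}` as a `piFinset` of integer intervals. [cite: Balaban1983Higgs3, (3.16) p.437] -/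
theorem mem_box_iff (M : ℕ) (u : ZSite d) :
    u ∈ Fintype.piFinset (fun _ : Fin d => Finset.Icc (-(M : ℤ)) M) ↔ supNorm u ≤ M := by
  rw [Fintype.mem_piFinset, supNorm_le_iff]
  refine forall_congr' fun μ => ?_
  rw [Finset.mem_Icc]
  omega

/-- kernel: the box `{u : |u|_∞ ≤ M}` has `(2M+1)^d` points. [cite: Balaban1983Higgs3, (3.16) p.437] -/
theorem card_box (M : ℕ) : (Fintype.piFinset (fun _ : Fin d => Finset.Icc (-(M : ℤ)) M)).card = (2 * M + 1) ^ d := by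
  rw [Fintype.card_piFinset_const, Int.card_Icc]
  congr 1
  omega

/-! ## §2 Shell counting in ℤ³ -/

/-- kernel: the shell `{u : |u|_∞ = n}` (inside any box) has at most `(2n+1)³ − (2n−1)³ = 24n² + 2 ≤ 26n²` points, `n ≥ 1`
(`d = 3`). [cite: Balaban1983Higgs3, (3.16) p.437] -/
theorem card_shell_le (M n : ℕ) (hn : 1 ≤ n) :
    (((Fintype.piFinset (fun _ : Fin 3 => Finset.Icc (-(M : ℤ)) M)).filter (fun u => supNorm u = n)).card : ℝ) ≤
      26 * (n : ℝ) ^ 2 := by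
  set B : ℕ → Finset (ZSite 3) := fun K => Fintype.piFinset (fun _ : Fin 3 => Finset.Icc (-(K : ℤ)) K) with hB
  have hsub : (B M).filter (fun u => supNorm u = n) ⊆ B n \ B (n - 1) := by
    intro u hu
    rw [Finset.mem_filter] at hu
    rw [Finset.mem_sdiff, hB, mem_box_iff, mem_box_iff]
    omega
  have hinc : B (n - 1) ⊆ B n := by
    intro u hu
    rw [hB, mem_box_iff] at hu ⊢
    omega
  have hcard : ((B n \ B (n - 1)).card : ℝ) = (2 * n + 1 : ℝ) ^ 3 - (2 * n - 1 : ℝ) ^ 3 := by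
    rw [Finset.card_sdiff_of_subset hinc, hB, card_box, card_box]
    have hle : (2 * (n - 1) + 1) ^ 3 ≤ (2 * n + 1) ^ 3 := Nat.pow_le_pow_left (by omega) 3
    rw [Nat.cast_sub hle]
    obtain ⟨m, rfl⟩ : ∃ m, n = m + 1 := ⟨n - 1, by omega⟩
    simp only [Nat.add_sub_cancel]
    push_cast
    ring
  calc (((B M).filter (fun u => supNorm u = n)).card : ℝ) ≤ ((B n \ B (n - 1)).card : ℝ) := by
        exact_mod_cast Finset.card_le_card hsub
    _ = (2 * n + 1 : ℝ) ^ 3 - (2 * n - 1 : ℝ) ^ 3 := hcard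
    _ = 24 * (n : ℝ) ^ 2 + 2 := by ring
    _ ≤ 26 * (n : ℝ) ^ 2 := by
        have : (1 : ℝ) ≤ n := by exact_mod_cast hn
        nlinarith

/-- kernel: RADIAL MAJORIZATION — a finite lattice sum of a nonnegative function of `|u|_∞` is at most its value at `0` plus the
shell-weighted one-dimensional sum: `Σ_{u∈F} h(|u|_∞) ≤ h(0) + Σ_{1≤n≤M} 26n²·h(n)`, `M = max_F |u|_∞` (`d = 3`).
[cite: Balaban1983Higgs3, (3.16) p.437] -/
theorem sum_radial_le (h : ℕ → ℝ) (hh : ∀ n, 0 ≤ h n) (F : Finset (ZSite 3)) :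
    ∑ u ∈ F, h (supNorm u) ≤ h 0 + ∑ n ∈ Finset.Ico 1 (F.sup supNorm + 1), 26 * (n : ℝ) ^ 2 * h n := by
  classical
  set M := F.sup supNorm with hM
  set B : Finset (ZSite 3) := Fintype.piFinset (fun _ : Fin 3 => Finset.Icc (-(M : ℤ)) M) with hB
  have hFB : F ⊆ B := by
    intro u hu
    rw [hB, mem_box_iff]
    exact Finset.le_sup (f := supNorm) hu
  have hmaps : ∀ u ∈ B, supNorm u ∈ Finset.range (M + 1) := by
    intro u hu
    rw [hB, mem_box_iff] at hu
    rw [Finset.mem_range]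
    omega
  have h1 : ∑ u ∈ F, h (supNorm u) ≤ ∑ u ∈ B, h (supNorm u) :=
    Finset.sum_le_sum_of_subset_of_nonneg hFB fun u _ _ => hh _
  have h2 : ∑ u ∈ B, h (supNorm u) = ∑ n ∈ Finset.range (M + 1), ((B.filter (fun u => supNorm u = n)).card : ℝ) * h n := by
    rw [← Finset.sum_fiberwise_of_maps_to' hmaps]
    refine Finset.sum_congr rfl fun n _ => ?_
    rw [Finset.sum_const, nsmul_eq_mul]
  have h3 : ∑ n ∈ Finset.range (M + 1), ((B.filter (fun u => supNorm u = n)).card : ℝ) * h n =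
      ((B.filter (fun u => supNorm u = 0)).card : ℝ) * h 0 +
        ∑ n ∈ Finset.Ico 1 (M + 1), ((B.filter (fun u => supNorm u = n)).card : ℝ) * h n := by
    rw [Finset.range_eq_Ico]
    rw [← Finset.sum_Ico_consecutive _ (Nat.zero_le 1) (by omega : 1 ≤ M + 1)]
    simp
  have h4 : ((B.filter (fun u => supNorm u = 0)).card : ℝ) ≤ 1 := by
    have hsub : B.filter (fun u => supNorm u = 0) ⊆ {0} := by
      intro u hu
      rw [Finset.mem_filter] at hu
      rw [Finset.mem_singleton]
      exact (supNorm_eq_zero_iff u).1 hu.2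
    have := Finset.card_le_card hsub
    rw [Finset.card_singleton] at this
    exact_mod_cast this
  have h5 : ∑ n ∈ Finset.Ico 1 (M + 1), ((B.filter (fun u => supNorm u = n)).card : ℝ) * h n ≤
      ∑ n ∈ Finset.Ico 1 (M + 1), 26 * (n : ℝ) ^ 2 * h n := by
    refine Finset.sum_le_sum fun n hn => ?_
    rw [Finset.mem_Ico] at hn
    exact mul_le_mul_of_nonneg_right (card_shell_le M n hn.1) (hh n)
  calc ∑ u ∈ F, h (supNorm u) ≤ ∑ u ∈ B, h (supNorm u) := h1
    _ = _ := h2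
    _ = _ := h3
    _ ≤ 1 * h 0 + ∑ n ∈ Finset.Ico 1 (M + 1), 26 * (n : ℝ) ^ 2 * h n :=
        add_le_add (mul_le_mul_of_nonneg_right h4 (hh 0)) h5
    _ = _ := by rw [one_mul]

/-! ## §3 One-dimensional exponential sums -/

/-- kernel: for `x > 0`, `Σ_{1 ≤ n < b} e^{−xn} ≤ e^{−x}/(1 − e^{−x})` (geometric series). [folklore] -/
private theorem sum_Ico_exp_le_geom {x : ℝ} (hx : 0 < x) (b : ℕ) :
    ∑ n ∈ Finset.Ico 1 b, Real.exp (-(x * n)) ≤ Real.exp (-x) / (1 - Real.exp (-x)) := by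
  have hr0 : 0 ≤ Real.exp (-x) := (Real.exp_pos _).le
  have hr1 : Real.exp (-x) < 1 := Real.exp_lt_one_iff.2 (by linarith)
  have h := geom_sum_Ico_le_of_lt_one hr0 hr1 (m := 1) (n := b)
  rw [pow_one] at h
  refine le_trans (le_of_eq (Finset.sum_congr rfl fun n _ => ?_)) h
  rw [← Real.exp_nat_mul]
  ring_nf

/-- kernel: `e^{−x}/(1 − e^{−x}) ≤ 1/x` and `≤ e^{−x}(1 + 1/x)` for `x > 0` (from `e^x ≥ 1 + x`). [folklore] -/
private theorem geom_ratio_le {x : ℝ} (hx : 0 < x) :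
    Real.exp (-x) / (1 - Real.exp (-x)) ≤ 1 / x ∧
      Real.exp (-x) / (1 - Real.exp (-x)) ≤ Real.exp (-x) * (1 + 1 / x) := by
  have hex : x + 1 ≤ Real.exp x := Real.add_one_le_exp x
  have hpos : 0 < Real.exp x := Real.exp_pos x
  have hem : Real.exp (-x) = (Real.exp x)⁻¹ := Real.exp_neg x
  have hden : 1 - Real.exp (-x) = (Real.exp x - 1) / Real.exp x := by
    rw [hem]; field_simp
  have hsub : 0 < Real.exp x - 1 := by linarith
  have hq : Real.exp (-x) / (1 - Real.exp (-x)) = 1 / (Real.exp x - 1) := by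
    rw [hden, hem]; field_simp
  rw [hq]
  constructor
  · exact one_div_le_one_div_of_le hx (by linarith)
  · rw [hem]
    rw [div_le_iff₀ hsub]
    have : (Real.exp x)⁻¹ * (1 + 1 / x) * (Real.exp x - 1) = (1 + 1 / x) * (1 - (Real.exp x)⁻¹) := by
      field_simp
    rw [this]
    have h1 : 1 - (Real.exp x)⁻¹ ≥ x / (x + 1) := by
      have h2 : (Real.exp x)⁻¹ ≤ (x + 1)⁻¹ := by
        rw [inv_le_inv₀ hpos (by linarith)]; exact hex
      have h3 : x / (x + 1) = 1 - (x + 1)⁻¹ := by field_simp; ring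
      rw [h3]; linarith
    have h4 : (1 + 1 / x) * (x / (x + 1)) = 1 := by field_simp
    calc (1 : ℝ) = (1 + 1 / x) * (x / (x + 1)) := h4.symm
      _ ≤ (1 + 1 / x) * (1 - (Real.exp x)⁻¹) := mul_le_mul_of_nonneg_left h1 (by positivity)

/-- kernel: `n^m ≤ (4/x)^m e^{xn/2}` for `m ≤ 2`, `x > 0`, `n ≥ 0` (from `xn/4 ≤ e^{xn/4}`). [folklore] -/
private theorem pow_le_mul_exp {x : ℝ} (hx : 0 < x) {m : ℕ} (hm : m ≤ 2) (n : ℕ) :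
    (n : ℝ) ^ m ≤ (4 / x) ^ m * Real.exp (x * n / 2) := by
  have h1 : x * n / 4 ≤ Real.exp (x * n / 4) := by
    have := Real.add_one_le_exp (x * n / 4); linarith
  have h2 : (n : ℝ) ≤ 4 / x * Real.exp (x * n / 4) := by
    rw [div_mul_eq_mul_div, le_div_iff₀ hx]; linarith
  have h3 : (n : ℝ) ^ m ≤ (4 / x * Real.exp (x * n / 4)) ^ m := pow_le_pow_left₀ (Nat.cast_nonneg n) h2 m
  rw [mul_pow, ← Real.exp_nat_mul] at h3
  refine h3.trans (mul_le_mul_of_nonneg_left (Real.exp_le_exp.2 ?_) (by positivity))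
  have hm' : (m : ℝ) ≤ 2 := by exact_mod_cast hm
  have : 0 ≤ x * n := by positivity
  nlinarith

/-- kernel: `Σ_{1 ≤ n < b} n^m e^{−xn} ≤ 32/x^{m+1}` for `m ≤ 2`, `x > 0`, uniformly in `b`. [cite: Balaban1983Higgs3, (3.16) p.437] -/
theorem sum_Ico_pow_mul_exp_le {x : ℝ} (hx : 0 < x) {m : ℕ} (hm : m ≤ 2) (b : ℕ) :
    ∑ n ∈ Finset.Ico 1 b, (n : ℝ) ^ m * Real.exp (-(x * n)) ≤ 32 / x ^ (m + 1) := by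
  have hx2 : 0 < x / 2 := by positivity
  have hterm : ∀ n : ℕ, (n : ℝ) ^ m * Real.exp (-(x * n)) ≤ (4 / x) ^ m * Real.exp (-(x / 2 * n)) := by
    intro n
    have h := pow_le_mul_exp hx hm n
    have he : Real.exp (x * n / 2) * Real.exp (-(x * n)) = Real.exp (-(x / 2 * n)) := by
      rw [← Real.exp_add]; ring_nf
    calc (n : ℝ) ^ m * Real.exp (-(x * n)) ≤ (4 / x) ^ m * Real.exp (x * n / 2) * Real.exp (-(x * n)) :=
          mul_le_mul_of_nonneg_right h (Real.exp_pos _).le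
      _ = (4 / x) ^ m * Real.exp (-(x / 2 * n)) := by rw [mul_assoc, he]
  have hgeom := (sum_Ico_exp_le_geom hx2 b).trans (geom_ratio_le hx2).1
  calc ∑ n ∈ Finset.Ico 1 b, (n : ℝ) ^ m * Real.exp (-(x * n))
      ≤ ∑ n ∈ Finset.Ico 1 b, (4 / x) ^ m * Real.exp (-(x / 2 * n)) := Finset.sum_le_sum fun n _ => hterm n
    _ = (4 / x) ^ m * ∑ n ∈ Finset.Ico 1 b, Real.exp (-(x / 2 * n)) := by rw [Finset.mul_sum]
    _ ≤ (4 / x) ^ m * (1 / (x / 2)) := mul_le_mul_of_nonneg_left hgeom (by positivity)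
    _ = 2 * 4 ^ m / x ^ (m + 1) := by rw [div_pow, pow_succ]; field_simp
    _ ≤ 32 / x ^ (m + 1) := by
        refine div_le_div_of_nonneg_right ?_ (by positivity)
        interval_cases m <;> norm_num

/-- kernel: the exponentially small form `Σ_{1 ≤ n < b} n²e^{−xn} ≤ (16/x²)(1 + 2/x)e^{−x/2}` (`x > 0`).
[cite: Balaban1983Higgs3, (3.16) p.437] -/
theorem sum_Ico_sq_mul_exp_le {x : ℝ} (hx : 0 < x) (b : ℕ) :
    ∑ n ∈ Finset.Ico 1 b, (n : ℝ) ^ 2 * Real.exp (-(x * n)) ≤ 16 / x ^ 2 * (1 + 2 / x) * Real.exp (-(x / 2)) := by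
  have hx2 : 0 < x / 2 := by positivity
  have hterm : ∀ n : ℕ, (n : ℝ) ^ 2 * Real.exp (-(x * n)) ≤ (4 / x) ^ 2 * Real.exp (-(x / 2 * n)) := by
    intro n
    have h := pow_le_mul_exp hx (le_refl 2) n
    have he : Real.exp (x * n / 2) * Real.exp (-(x * n)) = Real.exp (-(x / 2 * n)) := by
      rw [← Real.exp_add]; ring_nf
    calc (n : ℝ) ^ 2 * Real.exp (-(x * n)) ≤ (4 / x) ^ 2 * Real.exp (x * n / 2) * Real.exp (-(x * n)) :=
          mul_le_mul_of_nonneg_right h (Real.exp_pos _).le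
      _ = (4 / x) ^ 2 * Real.exp (-(x / 2 * n)) := by rw [mul_assoc, he]
  have hgeom := (sum_Ico_exp_le_geom hx2 b).trans (geom_ratio_le hx2).2
  calc ∑ n ∈ Finset.Ico 1 b, (n : ℝ) ^ 2 * Real.exp (-(x * n))
      ≤ ∑ n ∈ Finset.Ico 1 b, (4 / x) ^ 2 * Real.exp (-(x / 2 * n)) := Finset.sum_le_sum fun n _ => hterm n
    _ = (4 / x) ^ 2 * ∑ n ∈ Finset.Ico 1 b, Real.exp (-(x / 2 * n)) := by rw [Finset.mul_sum]
    _ ≤ (4 / x) ^ 2 * (Real.exp (-(x / 2)) * (1 + 1 / (x / 2))) := mul_le_mul_of_nonneg_left hgeom (by positivity)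
    _ = 16 / x ^ 2 * (1 + 2 / x) * Real.exp (-(x / 2)) := by
        rw [div_pow]
        have : 1 / (x / 2) = 2 / x := by field_simp
        rw [this]; ring

/-! ## §4 The profile sums on ξℤ³, uniformly in the spacing -/

/-- **`L¹` norms of the kernel profiles, uniformly in the lattice spacing**: for `0 < ξ ≤ 1`, `0 < δ ≤ 1` and `q ≤ 2` the lattice
function `u ↦ ξ³·(ξ·max(1,|u|_∞))^{−q}·e^{−δξ|u|_∞}` on ℤ³ is summable with sum `≤ 833/δ³` — the shape in which the p. 437 bounds
*"|C^ξ(y−y′)| ≦ O(1)e^{−½|y−y′|}/|y−y′| … and the corresponding inequalities for derivatives"* are summed over the ξ-lattice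
(`q = 1`: the propagator; `q = 2`: one lattice derivative). [cite: Balaban1983Higgs3, (3.16) p.437] -/
theorem tsum_profile_le {d : ℕ} (hd : d = 3) {ξ δ : ℝ} (hξ : 0 < ξ) (hξ1 : ξ ≤ 1) (hδ : 0 < δ) (hδ1 : δ ≤ 1)
    {q : ℕ} (hq : q ≤ 2) :
    Summable (fun u : ZSite d =>
        ξ ^ 3 * (((ξ * max 1 (supNorm u : ℝ)) ^ q)⁻¹ * Real.exp (-(δ * (ξ * (supNorm u : ℝ)))))) ∧
      ∑' u : ZSite d, ξ ^ 3 * (((ξ * max 1 (supNorm u : ℝ)) ^ q)⁻¹ * Real.exp (-(δ * (ξ * (supNorm u : ℝ))))) ≤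
        833 / δ ^ 3 := by
  subst hd
  set h : ℕ → ℝ := fun n => ξ ^ 3 * (((ξ * max 1 (n : ℝ)) ^ q)⁻¹ * Real.exp (-(δ * (ξ * (n : ℝ))))) with hh
  have hh0 : ∀ n, 0 ≤ h n := fun n => by positivity
  have hδξ : 0 < δ * ξ := mul_pos hδ hξ
  -- the bound on finite sums
  have hfin : ∀ F : Finset (ZSite 3), ∑ u ∈ F, h (supNorm u) ≤ 833 / δ ^ 3 := by
    intro F
    refine (sum_radial_le h hh0 F).trans ?_
    -- the value at 0
    have hz : h 0 ≤ 1 := by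
      simp only [hh, Nat.cast_zero, max_eq_left (zero_le_one' ℝ), mul_one, mul_zero, neg_zero, Real.exp_zero]
      calc ξ ^ 3 * (ξ ^ q)⁻¹ = ξ ^ (3 - q) := by
            rw [pow_sub₀ ξ hξ.ne' (by omega : q ≤ 3)]
        _ ≤ 1 := pow_le_one₀ hξ.le hξ1
    -- the shell sum
    have hshell : ∀ n : ℕ, 1 ≤ n → 26 * (n : ℝ) ^ 2 * h n =
        26 * ξ ^ (3 - q) * ((n : ℝ) ^ (2 - q) * Real.exp (-(δ * ξ * n))) := by
      intro n hn
      have hn1 : (1 : ℝ) ≤ n := by exact_mod_cast hn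
      simp only [hh, max_eq_right hn1]
      have hnq : (n : ℝ) ^ 2 = (n : ℝ) ^ (2 - q) * (n : ℝ) ^ q := by rw [← pow_add]; congr 1; omega
      have hξq : ξ ^ 3 = ξ ^ (3 - q) * ξ ^ q := by rw [← pow_add]; congr 1; omega
      rw [hnq, hξq, mul_pow, mul_inv]
      have hn0 : (n : ℝ) ^ q ≠ 0 := pow_ne_zero _ (by linarith)
      have hξ0 : ξ ^ q ≠ 0 := pow_ne_zero _ hξ.ne'
      field_simp
    have hS : ∑ n ∈ Finset.Ico 1 (F.sup supNorm + 1), 26 * (n : ℝ) ^ 2 * h n ≤ 832 / δ ^ 3 := by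
      rw [Finset.sum_congr rfl fun n hn => hshell n (Finset.mem_Ico.1 hn).1, ← Finset.mul_sum]
      have h1 := sum_Ico_pow_mul_exp_le hδξ (m := 2 - q) (by omega) (F.sup supNorm + 1)
      have h2 : 26 * ξ ^ (3 - q) * (32 / (δ * ξ) ^ (2 - q + 1)) = 832 / δ ^ (3 - q) := by
        rw [show 2 - q + 1 = 3 - q by omega, mul_pow]
        have : ξ ^ (3 - q) ≠ 0 := pow_ne_zero _ hξ.ne'
        field_simp
        ring
      have h3 : 832 / δ ^ (3 - q) ≤ 832 / δ ^ 3 :=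
        div_le_div_of_nonneg_left (by norm_num) (pow_pos hδ 3) (pow_le_pow_of_le_one hδ.le hδ1 (by omega))
      calc 26 * ξ ^ (3 - q) * ∑ n ∈ Finset.Ico 1 (F.sup supNorm + 1), (n : ℝ) ^ (2 - q) * Real.exp (-(δ * ξ * n))
          ≤ 26 * ξ ^ (3 - q) * (32 / (δ * ξ) ^ (2 - q + 1)) := mul_le_mul_of_nonneg_left h1 (by positivity)
        _ = 832 / δ ^ (3 - q) := h2
        _ ≤ 832 / δ ^ 3 := h3
    have h13 : (1 : ℝ) ≤ 1 / δ ^ 3 := by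
      rw [le_div_iff₀ (pow_pos hδ 3), one_mul]
      exact pow_le_one₀ hδ.le hδ1
    calc h 0 + _ ≤ 1 + 832 / δ ^ 3 := add_le_add hz hS
      _ ≤ 1 / δ ^ 3 + 832 / δ ^ 3 := by linarith
      _ = 833 / δ ^ 3 := by ring
  have hsum : Summable (fun u : ZSite 3 => h (supNorm u)) := summable_of_sum_le (fun u => hh0 _) hfin
  exact ⟨hsum, Real.tsum_le_of_sum_le (fun u => hh0 _) hfin⟩

/-- **Exponentially small shell sums** `Σ_{k ∈ ℤ³, k ≠ 0} e^{−a|k|_∞} ≤ (416/a²)(1 + 2/a)e^{−a/2}` (`a > 0`): the sum over the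
non-zero period shifts of the torus (the wrap-around terms of the periodized kernels, `a = ξN·rate`), and the summability of
`k ↦ e^{−a|k|_∞}`. [cite: Balaban1983Higgs3, (3.16) p.437] -/
theorem tsum_exp_supNorm_le {d : ℕ} (hd : d = 3) {a : ℝ} (ha : 0 < a) :
    Summable (fun k : ZSite d => Real.exp (-(a * (supNorm k : ℝ)))) ∧
      Summable (fun k : ZSite d => if k = 0 then (0 : ℝ) else Real.exp (-(a * (supNorm k : ℝ)))) ∧
      ∑' k : ZSite d, (if k = 0 then (0 : ℝ) else Real.exp (-(a * (supNorm k : ℝ)))) ≤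
        416 / a ^ 2 * (1 + 2 / a) * Real.exp (-(a / 2)) := by
  subst hd
  set h : ℕ → ℝ := fun n => if n = 0 then 0 else Real.exp (-(a * n)) with hh
  have hh0 : ∀ n, 0 ≤ h n := fun n => by simp only [hh]; split_ifs <;> positivity
  have hkey : ∀ k : ZSite 3, (if k = 0 then (0 : ℝ) else Real.exp (-(a * (supNorm k : ℝ)))) = h (supNorm k) := by
    intro k
    simp only [hh]
    by_cases hk : k = 0
    · rw [if_pos hk, if_pos ((supNorm_eq_zero_iff k).2 hk)]
    · rw [if_neg hk, if_neg (fun h0 => hk ((supNorm_eq_zero_iff k).1 h0))]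
  have hfin : ∀ F : Finset (ZSite 3), ∑ u ∈ F, h (supNorm u) ≤ 416 / a ^ 2 * (1 + 2 / a) * Real.exp (-(a / 2)) := by
    intro F
    refine (sum_radial_le h hh0 F).trans ?_
    have hz : h 0 = 0 := by simp [hh]
    rw [hz, zero_add]
    have hshell : ∀ n ∈ Finset.Ico 1 (F.sup supNorm + 1), 26 * (n : ℝ) ^ 2 * h n = 26 * ((n : ℝ) ^ 2 * Real.exp (-(a * n))) := by
      intro n hn
      have hn1 : n ≠ 0 := by have := (Finset.mem_Ico.1 hn).1; omega
      simp only [hh, if_neg hn1]; ring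
    rw [Finset.sum_congr rfl hshell, ← Finset.mul_sum]
    calc 26 * ∑ n ∈ Finset.Ico 1 (F.sup supNorm + 1), (n : ℝ) ^ 2 * Real.exp (-(a * n))
        ≤ 26 * (16 / a ^ 2 * (1 + 2 / a) * Real.exp (-(a / 2))) :=
          mul_le_mul_of_nonneg_left (sum_Ico_sq_mul_exp_le ha _) (by norm_num)
      _ = 416 / a ^ 2 * (1 + 2 / a) * Real.exp (-(a / 2)) := by ring
  have hfull : ∀ F : Finset (ZSite 3), ∑ u ∈ F, Real.exp (-(a * (supNorm u : ℝ))) ≤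
      1 + 416 / a ^ 2 * (1 + 2 / a) * Real.exp (-(a / 2)) := by
    intro F
    refine (sum_radial_le (fun n => Real.exp (-(a * n))) (fun n => (Real.exp_pos _).le) F).trans ?_
    simp only [Nat.cast_zero, mul_zero, neg_zero, Real.exp_zero]
    gcongr 1 + ?_
    have hre : ∀ n ∈ Finset.Ico 1 (F.sup supNorm + 1),
        26 * (n : ℝ) ^ 2 * Real.exp (-(a * n)) = 26 * ((n : ℝ) ^ 2 * Real.exp (-(a * n))) := fun n _ => by ring
    rw [Finset.sum_congr rfl hre, ← Finset.mul_sum]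
    calc 26 * ∑ n ∈ Finset.Ico 1 (F.sup supNorm + 1), (n : ℝ) ^ 2 * Real.exp (-(a * n))
        ≤ 26 * (16 / a ^ 2 * (1 + 2 / a) * Real.exp (-(a / 2))) :=
          mul_le_mul_of_nonneg_left (sum_Ico_sq_mul_exp_le ha _) (by norm_num)
      _ = 416 / a ^ 2 * (1 + 2 / a) * Real.exp (-(a / 2)) := by ring
  refine ⟨summable_of_sum_le (fun u => (Real.exp_pos _).le) hfull, ?_, ?_⟩
  · simp_rw [hkey]
    exact summable_of_sum_le (fun u => hh0 _) hfin
  · simp_rw [hkey]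
    exact Real.tsum_le_of_sum_le (fun u => hh0 _) hfin

/-- kernel: the profiles are ANTITONE in the distance — outside the ball `|u|_∞ < R` a profile is bounded by its value at `R`
(`ξ > 0`, `δ ≥ 0`). [cite: Balaban1983Higgs3, (3.16) p.437] -/
theorem profile_antitone {ξ δ R : ℝ} (hξ : 0 < ξ) (hδ : 0 ≤ δ) (q : ℕ) (u : ZSite d)
    (hu : R ≤ (supNorm u : ℝ)) :
    ((ξ * max 1 (supNorm u : ℝ)) ^ q)⁻¹ * Real.exp (-(δ * (ξ * (supNorm u : ℝ)))) ≤
      ((ξ * max 1 R) ^ q)⁻¹ * Real.exp (-(δ * (ξ * R))) := by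
  have h1 : ((ξ * max 1 (supNorm u : ℝ)) ^ q)⁻¹ ≤ ((ξ * max 1 R) ^ q)⁻¹ := by
    refine inv_anti₀ (by positivity) (pow_le_pow_left₀ (by positivity) ?_ q)
    exact mul_le_mul_of_nonneg_left (max_le_max le_rfl hu) hξ.le
  have h2 : Real.exp (-(δ * (ξ * (supNorm u : ℝ)))) ≤ Real.exp (-(δ * (ξ * R))) :=
    Real.exp_le_exp.2 (by nlinarith [mul_le_mul_of_nonneg_left hu hξ.le])
  exact mul_le_mul h1 h2 (Real.exp_pos _).le (by positivity)

/-! ## §5 A lattice convolution at a far point: the "sup × L¹" estimate -/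

/-- **The wrap-around estimate, abstract form** (any dimension): if `F, G ≥ 0` are summable on ℤ^d with `F ≤ s_F` and `G ≤ s_G`
outside the ball `|·|_∞ < R`, then at every `v` with `|v|_∞ ≥ 2R` the convolution `Σ_w F(w)G(v − w)` is summable and
`≤ s_F·Σ'G + (Σ'F)·s_G` — in each term one of `w`, `v − w` is at sup-distance `≥ R` from the origin.  (Used at `v = Nk`, `k ≠ 0`:
the period-shifted copies of the kernels of (3.26)/(3.27) on the torus.) [cite: Balaban1983Higgs3, (3.27) p.441] -/
theorem tsum_mul_sub_le_far {F G : ZSite d → ℝ} (hF0 : ∀ w, 0 ≤ F w) (hG0 : ∀ u, 0 ≤ G u) (hF : Summable F)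
    (hG : Summable G) {R sF sG : ℝ} (hsF0 : 0 ≤ sF) (hsG0 : 0 ≤ sG) (hsF : ∀ w, R ≤ (supNorm w : ℝ) → F w ≤ sF)
    (hsG : ∀ u, R ≤ (supNorm u : ℝ) → G u ≤ sG) (v : ZSite d) (hv : 2 * R ≤ (supNorm v : ℝ)) :
    Summable (fun w => F w * G (v - w)) ∧
      ∑' w, F w * G (v - w) ≤ sF * ∑' u, G u + (∑' w, F w) * sG := by
  -- pointwise domination
  have hpt : ∀ w, F w * G (v - w) ≤ sF * G (v - w) + F w * sG := by
    intro w
    by_cases hw : R ≤ (supNorm w : ℝ)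
    · have h1 : F w * G (v - w) ≤ sF * G (v - w) := mul_le_mul_of_nonneg_right (hsF w hw) (hG0 _)
      have h2 : 0 ≤ F w * sG := mul_nonneg (hF0 w) hsG0
      linarith
    · rw [not_le] at hw
      have htri : (supNorm v : ℝ) ≤ (supNorm w : ℝ) + (supNorm (v - w) : ℝ) := by
        exact_mod_cast supNorm_le_add_sub v w
      have hfar : R ≤ (supNorm (v - w) : ℝ) := by linarith
      have h1 : F w * G (v - w) ≤ F w * sG := mul_le_mul_of_nonneg_left (hsG _ hfar) (hF0 w)
      have h2 : 0 ≤ sF * G (v - w) := mul_nonneg hsF0 (hG0 _)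
      linarith
  have hGv : Summable (fun w => G (v - w)) := (Equiv.subLeft v).summable_iff.2 hG
  have hGv_eq : ∑' w, G (v - w) = ∑' u, G u := (Equiv.subLeft v).tsum_eq G
  have hmaj : Summable (fun w => sF * G (v - w) + F w * sG) := (hGv.mul_left sF).add (hF.mul_right sG)
  have hsum : Summable (fun w => F w * G (v - w)) :=
    Summable.of_nonneg_of_le (fun w => mul_nonneg (hF0 w) (hG0 _)) hpt hmaj
  refine ⟨hsum, ?_⟩
  calc ∑' w, F w * G (v - w) ≤ ∑' w, (sF * G (v - w) + F w * sG) := hsum.tsum_le_tsum hpt hmaj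
    _ = sF * ∑' w, G (v - w) + (∑' w, F w) * sG := by
        rw [(hGv.mul_left sF).tsum_add (hF.mul_right sG), tsum_mul_left, tsum_mul_right]
    _ = sF * ∑' u, G u + (∑' w, F w) * sG := by rw [hGv_eq]

end

end Literature.MathematicalPhysics.QuantumFieldTheory.Balaban1983to89.B3ZdLatticeProfileSums
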